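import Summits.HodgeConjecture.HodgeConjecture.Theorems.F0P3cStCharTSWeylHypNormaliser   -- ★ p849560: `antidiagonal_over_apply`, `antidiagOne_mem_unitaryGroupOfForm` (the Weyl element `w`)
import Literature.NumberTheory.Automorphic.UnitaryGroupBorelPair                         -- ★ `glDiagonal_mem_unitaryGroupOfForm_antidiagonal_iff`
import HarnessLib

/-!
# F0 · P3c · line LH6 «StCharTS» — «WEYL-HYP★» (B2): THE WEYL SWAP ON THE SPLIT TORUS OF `U(σ, Φ₃)(R)` AND THE ROOT RELATIONS (R1)+(R2) behind `|D(m)|`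
# (ring identities for the van Dijk weight `wt` of LH6-p01's TERMS v2 and its W-invariance «VDW-SYMM★») [Rogawski1990 §12.2 p. 173, §12.5 p. 182, L. 12.7.2 p. 193]

Cell `pub/hodgecm-mathlib`, crux H413 = `stmt-HodgeConjecture-24833` (`--supports` lane, helper), route HCCMUnconditional; seat LH2-p01 (g3), deal «(B2)» of F0P3b-plan (g23)
2026-09-02T05:37:41Z.  THEOREMS ONLY, sorry-free, no definition ∕ instance ∕ notation ∕ named fact.  CONVENTION-FREE RING ALGEBRA over ANY commutative ring `R` with an endomorphism
`σ` (involutive where said), `J = Φ₃ = (StdForm.antidiagonal 3).over R`, the diagonal torus `T = torusU σ J` with entries `t = d(d₀, d₁, d₂)` subject to the TORUS RELATIONS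
`σ(d₂) d₀ = 1`, `σ(d₁) d₁ = 1`, `σ(d₀) d₂ = 1` (★ `glDiagonal_mem_unitaryGroupOfForm_antidiagonal_iff`).  The van Dijk weight of LH6-p01 (g2)'s TERMS v2 (1eb74f73) is
`wt t = δ_B^{1∕2}(t) · |a′|_E · |b′|` with the ROOT QUANTITIES `a′ = d₀⁻¹ d₁ − 1`, `b′ = d₀⁻¹ d₂ − 1`; under the Weyl swap `w : d(d₀,d₁,d₂) ↦ d(d₂,d₁,d₀)` they become
`a′_w = d₂⁻¹ d₁ − 1`, `b′_w = d₂⁻¹ d₀ − 1`.  This file proves the identities from which `|D(w·t)| = |D(t)|` («VDW-SYMM★», LH6-p02) and stage (B)'s Jacobian bookkeeping read off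
in one line each (`|σ x| = |x|`, `|u x| = |u||x|`):
* §1 (R1) **the Weyl swap**: `glDiagonal (d ∘ rev) ∈ U(σ, Φ₃)` iff `glDiagonal d ∈ U(σ, Φ₃)` (`glDiagonal_comp_rev_mem_iff`), and CONJUGATION BY THE WEYL ELEMENT `w` (matrix `Φ₃`)
  swaps the outer entries: `Φ₃ · diag(d) · Φ₃ = diag(d ∘ rev)` (`antidiag_mul_diagonal_mul_antidiag`), read in `U`: `w t w⁻¹ = d(d₂, d₁, d₀)` (`coe_weyl_conj_glDiagonal`).
* §2 (R2) **the torus dictionary and the root relations** under the torus relations: `σ(d₀) = d₂⁻¹`, `σ(d₁) = d₁⁻¹`, `σ(d₂) = d₀⁻¹`, `σ(d₀⁻¹) = d₂`, `σ(d₂⁻¹) = d₀`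
  (`sigma_coe_zero_eq`, `sigma_coe_one_eq`, `sigma_coe_two_eq`, `sigma_coe_inv_zero_eq`, `sigma_coe_inv_two_eq`); `σ(a′) = −(d₂ d₁⁻¹) · a′_w` (`sigma_rootA_eq`),
  `σ(b′) = b′` (`sigma_rootB_eq`: `b′` is `σ`-fixed), `σ(a′_w) = −(d₀ d₁⁻¹) · a′` (`sigma_rootA_weyl_eq`), `b′_w = −(d₀ d₂⁻¹) · b′` (`rootB_weyl_eq`) — so `|a′_w|_E`, `|b′_w|`
  differ from `|a′|_E`, `|b′|` by the unit factors `|d₀ d₁⁻¹|_E`, `|d₀ d₂⁻¹|`, which the `δ_B^{±1∕2}` swap absorbs («VDW-SYMM★» in one line each).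
(R3) — a closed form of `|D_G(t)|` in measure tokens — is deliberately NOT typed here (LH6-p01 (g2) 05:53:31Z: «PSM★»'s weight of record is ★ (4.9.4)'s `vanDijkWeight`; a second
spelling of `|D_G|` enters only if stage (B)'s measure identity (LH2-p02 (g3)) asks for it, in its tokens).
HONEST LABEL: HC_CM is proved only modulo the 7 printed citations (2 remaining: hLiu418 = `stmt-HodgeConjecture-24832`, h413 = `stmt-HodgeConjecture-24833`) until rung 0
closes; count-neutral (TOR)-road algebra; closes no organ.

## References
* [Rogawski1990] J. D. Rogawski, *Automorphic Representations of Unitary Groups in Three Variables*, Ann. of Math. Stud. 123 (1990), §12.2 p. 173 (`W = {1, w}`, `w(α, β) = (ᾱ⁻¹, β)`),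
  §12.5 p. 182, L. 12.7.2 p. 193 (`Δ(m)`).
* [vanDijk1972] G. van Dijk, *Computation of certain induced characters of `p`-adic groups*, Math. Ann. 199 (1972), §2.
-/

set_option autoImplicit false
-- the mandated namespace has the single-problem summit's repeated segment (`HodgeConjecture.HodgeConjecture`)
set_option linter.dupNamespace false

open Matrix
open Literature.NumberTheory.Automorphic Literature.NumberTheory.Automorphic.UnitaryGroup
open Summit.HodgeConjecture.HodgeConjecture.Cruxes.H413.F0P3cStCharTSWeylHypNormaliser
open scoped MatrixGroups

namespace Summit.HodgeConjecture.HodgeConjecture.Cruxes.H413.F0P3cStCharTSWeylDiscriminant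

variable {R : Type*} [CommRing R] (σ : R →+* R)

/-! ## §1 (R1) The Weyl swap `d(d₀,d₁,d₂) ↦ d(d₂,d₁,d₀)` -/

/-- **(R1) The Weyl swap preserves the torus**: `diag(d ∘ rev) ∈ U(σ, Φ₃) ↔ diag(d) ∈ U(σ, Φ₃)` (the torus relations `σ(d_{2−i}) d_i = 1` are `rev`-symmetric as a set).
[cite: Rogawski1990, §12.2 p. 173] -/
theorem glDiagonal_comp_rev_mem_iff (d : Fin 3 → Rˣ) :
    glDiagonal 3 R (fun i => d i.rev) ∈ unitaryGroupOfForm σ ((StdForm.antidiagonal 3).over R) ↔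
      glDiagonal 3 R d ∈ unitaryGroupOfForm σ ((StdForm.antidiagonal 3).over R) := by
  rw [glDiagonal_mem_unitaryGroupOfForm_antidiagonal_iff, glDiagonal_mem_unitaryGroupOfForm_antidiagonal_iff]
  constructor
  · intro h i
    fin_cases i
    · simpa using h 2
    · simpa using h 1
    · simpa using h 0
  · intro h i
    fin_cases i
    · simpa using h 2
    · simpa using h 1
    · simpa using h 0

/-- **`Φ₃ · diag(d) · Φ₃ = diag(d ∘ rev)`**: conjugation by the antidiagonal Weyl matrix swaps the outer diagonal entries. [cite: Rogawski1990, §12.2 p. 173] -/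
theorem antidiag_mul_diagonal_mul_antidiag (d : Fin 3 → R) :
    (StdForm.antidiagonal 3).over R * diagonal d * (StdForm.antidiagonal 3).over R = diagonal fun i => d i.rev := by
  ext i j
  have hrev0 : (0 : Fin 3).rev = 2 := rfl
  have hrev1 : (1 : Fin 3).rev = 1 := rfl
  have hrev2 : (2 : Fin 3).rev = 0 := rfl
  fin_cases i <;> fin_cases j <;>
    simp [Matrix.mul_apply, Fin.sum_univ_three, antidiagonal_over_apply, diagonal, hrev0, hrev1, hrev2]

/-- **(R1) in `U(σ, Φ₃)`: `w · t · w⁻¹ = d(d₂, d₁, d₀)`** for `t = d(d₀,d₁,d₂) ∈ T` and the Weyl element `w` (the unit with matrix `Φ₃`, ★ `antidiagOne_mem_unitaryGroupOfForm`), as an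
identity of matrices. [cite: Rogawski1990, §12.2 p. 173; §12.5 p. 182] -/
theorem coe_weyl_conj_glDiagonal {J : Matrix (Fin 3) (Fin 3) R} (hJ : J = (StdForm.antidiagonal 3).over R) (d : Fin 3 → Rˣ) :
    J * (glDiagonal 3 R d : Matrix (Fin 3) (Fin 3) R) * J = (glDiagonal 3 R (fun i => d i.rev) : Matrix (Fin 3) (Fin 3) R) := by
  rw [coe_glDiagonal, coe_glDiagonal, hJ]
  exact antidiag_mul_diagonal_mul_antidiag fun k => (d k : R)

/-! ## §2 (R2) The torus dictionary `σ(d₀) = d₂⁻¹, σ(d₁) = d₁⁻¹, σ(d₂) = d₀⁻¹` and the root relations -/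

section RootRelations

variable {d : Fin 3 → Rˣ} (h : ∀ i : Fin 3, σ (d (Fin.rev i) : R) * (d i : R) = 1)
include h

/-- `σ(d₂) = d₀⁻¹` on the torus. [cite: Rogawski1990, §12.2 p. 173] -/
theorem sigma_coe_two_eq : σ (d 2 : R) = ((d 0)⁻¹ : Rˣ) := by
  have h0 := h 0
  have e : σ (d 2 : R) = σ (d 2 : R) * (d 0 : R) * ((d 0)⁻¹ : Rˣ) := by rw [mul_assoc, Units.mul_inv, mul_one]
  rw [e]; exact (by rw [show ((0 : Fin 3).rev) = 2 from rfl] at h0; rw [h0, one_mul])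

/-- `σ(d₁) = d₁⁻¹` on the torus. [cite: Rogawski1990, §12.2 p. 173] -/
theorem sigma_coe_one_eq : σ (d 1 : R) = ((d 1)⁻¹ : Rˣ) := by
  have h1 := h 1
  have e : σ (d 1 : R) = σ (d 1 : R) * (d 1 : R) * ((d 1)⁻¹ : Rˣ) := by rw [mul_assoc, Units.mul_inv, mul_one]
  rw [e]; exact (by rw [show ((1 : Fin 3).rev) = 1 from rfl] at h1; rw [h1, one_mul])

/-- `σ(d₀) = d₂⁻¹` on the torus. [cite: Rogawski1990, §12.2 p. 173] -/
theorem sigma_coe_zero_eq : σ (d 0 : R) = ((d 2)⁻¹ : Rˣ) := by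
  have h2 := h 2
  have e : σ (d 0 : R) = σ (d 0 : R) * (d 2 : R) * ((d 2)⁻¹ : Rˣ) := by rw [mul_assoc, Units.mul_inv, mul_one]
  rw [e]; exact (by rw [show ((2 : Fin 3).rev) = 0 from rfl] at h2; rw [h2, one_mul])

/-- `σ` of the inverse of a torus entry: `σ(d₀⁻¹) = d₂`, through `σ(d₀) = d₂⁻¹`. [cite: Rogawski1990, §12.2 p. 173] -/
theorem sigma_coe_inv_zero_eq : σ ((d 0)⁻¹ : Rˣ) = (d 2 : R) := by
  have e : σ ((d 0)⁻¹ : Rˣ) * σ (d 0 : R) = 1 := by rw [← map_mul, Units.inv_mul, map_one]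
  rw [sigma_coe_zero_eq σ h] at e
  calc σ ((d 0)⁻¹ : Rˣ) = σ ((d 0)⁻¹ : Rˣ) * ((d 2)⁻¹ : Rˣ) * (d 2 : R) := by rw [mul_assoc, Units.inv_mul, mul_one]
    _ = (d 2 : R) := by rw [e, one_mul]

/-- `σ(d₂⁻¹) = d₀`. [cite: Rogawski1990, §12.2 p. 173] -/
theorem sigma_coe_inv_two_eq : σ ((d 2)⁻¹ : Rˣ) = (d 0 : R) := by
  have e : σ ((d 2)⁻¹ : Rˣ) * σ (d 2 : R) = 1 := by rw [← map_mul, Units.inv_mul, map_one]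
  rw [sigma_coe_two_eq σ h] at e
  calc σ ((d 2)⁻¹ : Rˣ) = σ ((d 2)⁻¹ : Rˣ) * ((d 0)⁻¹ : Rˣ) * (d 0 : R) := by rw [mul_assoc, Units.inv_mul, mul_one]
    _ = (d 0 : R) := by rw [e, one_mul]

/-- **(R2a) `σ(a′) = −(d₂ d₁⁻¹) · a′_w`** for the root quantities `a′ = d₀⁻¹d₁ − 1`, `a′_w = d₂⁻¹d₁ − 1` (so `|σ(a′)|_E = |a′|_E` differs from `|a′_w|_E` by the unit factor
`|d₂ d₁⁻¹|_E`). [cite: Rogawski1990, §12.5 p. 182; L. 12.7.2 p. 193] -/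
theorem sigma_rootA_eq :
    σ (((d 0)⁻¹ : Rˣ) * (d 1 : R) - 1) = -((d 2 : R) * ((d 1)⁻¹ : Rˣ)) * (((d 2)⁻¹ : Rˣ) * (d 1 : R) - 1) := by
  rw [map_sub, map_one, map_mul, sigma_coe_inv_zero_eq σ h, sigma_coe_one_eq σ h]
  have h21 : ((d 2)⁻¹ : Rˣ) * (d 2 : R) = 1 := Units.inv_mul _
  have h11 : ((d 1)⁻¹ : Rˣ) * (d 1 : R) = 1 := Units.inv_mul _
  linear_combination (((d 1)⁻¹ : Rˣ) * (d 1 : R)) * h21 + h11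

/-- **(R2b) `σ(b′) = b′`**: the root quantity `b′ = d₀⁻¹ d₂ − 1` is `σ`-INVARIANT on the torus (`σ(d₀⁻¹) = d₂`, `σ(d₂) = d₀⁻¹`). [cite: Rogawski1990, §12.5 p. 182; L. 12.7.2 p. 193] -/
theorem sigma_rootB_eq : σ (((d 0)⁻¹ : Rˣ) * (d 2 : R) - 1) = ((d 0)⁻¹ : Rˣ) * (d 2 : R) - 1 := by
  rw [map_sub, map_one, map_mul, sigma_coe_inv_zero_eq σ h, sigma_coe_two_eq σ h, mul_comm]

/-- **(R2c) `σ(a′_w) = −(d₀ d₁⁻¹) · a′`** for `a′_w = d₂⁻¹ d₁ − 1`, `a′ = d₀⁻¹ d₁ − 1` (the mirror of (R2a)). [cite: Rogawski1990, §12.5 p. 182; L. 12.7.2 p. 193] -/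
theorem sigma_rootA_weyl_eq :
    σ (((d 2)⁻¹ : Rˣ) * (d 1 : R) - 1) = -((d 0 : R) * ((d 1)⁻¹ : Rˣ)) * (((d 0)⁻¹ : Rˣ) * (d 1 : R) - 1) := by
  rw [map_sub, map_one, map_mul, sigma_coe_inv_two_eq σ h, sigma_coe_one_eq σ h]
  have h01 : ((d 0)⁻¹ : Rˣ) * (d 0 : R) = 1 := Units.inv_mul _
  have h11 : ((d 1)⁻¹ : Rˣ) * (d 1 : R) = 1 := Units.inv_mul _
  linear_combination (((d 1)⁻¹ : Rˣ) * (d 1 : R)) * h01 + h11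

omit h in
/-- **(R2d) `b′_w = −(d₀ d₂⁻¹) · b′`** for `b′_w = d₂⁻¹ d₀ − 1`, `b′ = d₀⁻¹ d₂ − 1` (pure ring identity, no torus relation needed). [cite: Rogawski1990, L. 12.7.2 p. 193] -/
theorem rootB_weyl_eq : ((d 2)⁻¹ : Rˣ) * (d 0 : R) - 1 = -((d 0 : R) * ((d 2)⁻¹ : Rˣ)) * (((d 0)⁻¹ : Rˣ) * (d 2 : R) - 1) := by
  have h00 : (d 0 : R) * ((d 0)⁻¹ : Rˣ) = 1 := Units.mul_inv _
  have h22 : ((d 2)⁻¹ : Rˣ) * (d 2 : R) = 1 := Units.inv_mul _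
  linear_combination (((d 2)⁻¹ : Rˣ) * (d 2 : R)) * h00 + h22

end RootRelations

end Summit.HodgeConjecture.HodgeConjecture.Cruxes.H413.F0P3cStCharTSWeylDiscriminant
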